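import Summits.KontsevichZagierPeriods.KontsevichZagierPeriods.Theses.SymplecticScissors
import Summits.KontsevichZagierPeriods.KontsevichZagierPeriods.Theorems.PlanarK0Injective.Negative.Kit
import Literature.NumberTheory.Transcendental.CurvePeriods
import Literature.NumberTheory.Transcendental.BakerLogarithmsConclusion

/-!
# `PlanarK0Injective` (stmt-KontsevichZagierPeriods-9847) — line `mordell-weil-normal-form`,
lead skeleton (reshaped by the line lead, 2026-08-16)

The crux `SymplecticScissors.PlanarK0Injective`: two planar `ℚ`-semialgebraic sets of equal
finite area differ, in the free abelian group on planar sets, by an element of the planar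
set-chain group `G = closure((1a ∪ 2) ∩ closure planarGens)`.

Line (card `Ideas/mordell-weil-normal-form.md`): NORMAL FORM + INDEPENDENCE.
* `stub_cellReading` — every planar set is, modulo `G`, a finite sum of STANDARD CELLS
  `{0 < x < 1, 0 < y < g x}` (`g` `ℚ`-semialgebraic, `C¹`, positive, integrable on `(0,1)`):
  cylindrical decomposition, vertical shears, affine rescaling, compactification (all 1a / 2).
* `stub_scalarCalculus` — the `(ℚ̄ ∩ ℝ)`-linear bookkeeping inside `G`: cells of `|ν_k| · g` with
  algebraic `ν_k`, `Σ ν_k = 0`, cancel with signs `sign ν_k` (stacking shears + cuts along graphs).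
* `stub_mordellWeilNormalForm` (HARDEST, the lead's) — every finite family of standard cells
  reduces INSIDE `G` to algebraic multiples of a normal basis of standard cells whose areas are
  independent in one of three certified shapes: directly `ℚ̄`-linearly independent, TORIC
  (`1, log bᵢ, arctan βₖ` with `ℚ`-independent logarithms), or realised by FORMALLY INDEPENDENT
  period symbols of curve type (`CurvePeriods.PeriodSymbol`).
* `stub_logCellLaw` — registered helper of the normal form (rung 0): `log(ab) = log a + log b`
  as planar cut-and-paste of hyperbola cells (one cut, one hyperbolic dilation).
* `stub_arctanCellLaw` — registered helper (rung 0): `arctan(β⊕γ) = arctan β + arctan γ` as planar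
  cut-and-paste of arctangent cells (one cut, one Möbius `FiniteMapShear`).
* `stub_toricIndependence` — Baker's theorem (`baker_holds`, PROVED in the tree) in real clothes:
  `1, log bᵢ, arctan βₖ` are `ℚ̄ ∩ ℝ`-independent when `log bᵢ, i·arctan βₖ` are `ℚ`-independent.
* `stub_huberWustholz` — the named fact `HuberWustholzCurvePeriods` (HW 2022 Thm 13.3 (2)),
  which turns formal independence of symbols into independence of their periods.
Composition `PlanarK0Injective_of`: read both sets as cells, reduce the joint family to a normal
basis, equal areas + independence force equal normal coordinates, and `stub_scalarCalculus`
cancels coordinate by coordinate inside `G`.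

All stub signatures are written over importable declarations only (no local definitions), so
that each stub can be landed verbatim as its own `Theorems/` file.
-/

noncomputable section

open MeasureTheory Set
open Literature.NumberTheory.Transcendental
open Summit.KontsevichZagierPeriods.SymplecticScissors.PlanarK0InjectiveNegative (planarGroup
  eval_eq_zero_of_mem_planarGroup)
open Summit.KontsevichZagierPeriods.KontsevichZagierPeriods.Theses.SymplecticScissors (PlanarK0Injective)

namespace Summit.KontsevichZagierPeriods.SymplecticScissors.MordellWeil

/-! ## The five stubs -/

/-- **Stub 1 (cell reading).** Every planar set (integrand `1`) is congruent modulo the planar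
set-chain group to a finite sum of standard cells `{0 < x < 1, 0 < y < g x}` with `g`
`ℚ`-semialgebraic, `C¹`, positive and integrable on `(0,1)`. [folklore] -/
theorem stub_cellReading :
    ∀ (r : KZ.IntegralRep 2), (∀ p ∈ r.domain, r.integrand p = 1) →
      ∃ (n : ℕ) (g : Fin n → ℝ → ℝ) (c : Fin n → KZ.IntegralRep 2),
        (∀ i, IsSemialgebraicFunOn ℚ {z : Fin 1 → ℝ | z 0 ∈ Set.Ioo (0 : ℝ) 1} (fun z => g i (z 0)) ∧
          ContDiffOn ℝ 1 (g i) (Set.Ioo (0 : ℝ) 1) ∧ (∀ x ∈ Set.Ioo (0 : ℝ) 1, 0 < g i x) ∧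
          IntegrableOn (g i) (Set.Ioo (0 : ℝ) 1)) ∧
        (∀ i, (c i).domain = {p : Fin 2 → ℝ | p 0 ∈ Set.Ioo (0 : ℝ) 1 ∧ 0 < p 1 ∧ p 1 < g i (p 0)} ∧
          ∀ p ∈ (c i).domain, (c i).integrand p = 1) ∧
        KZ.of r - ∑ i, KZ.of (c i) ∈ planarGroup := by
  sorry

/-- **Stub 2 (scalar calculus inside the planar group).** For a standard density `g`, algebraic
scalars `ν_k` with `Σ ν_k = 0` and cells `e_k` of `|ν_k| · g`, the signed sum
`Σ sign(ν_k) [e_k]` lies in the planar set-chain group (stacking shears `(x, y) ↦ (x, y − a g x)`,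
cuts along graphs, null segments). [folklore] -/
theorem stub_scalarCalculus :
    ∀ (g : ℝ → ℝ),
      (IsSemialgebraicFunOn ℚ {z : Fin 1 → ℝ | z 0 ∈ Set.Ioo (0 : ℝ) 1} (fun z => g (z 0)) ∧
        ContDiffOn ℝ 1 g (Set.Ioo (0 : ℝ) 1) ∧ (∀ x ∈ Set.Ioo (0 : ℝ) 1, 0 < g x) ∧
        IntegrableOn g (Set.Ioo (0 : ℝ) 1)) →
      ∀ (K : Type) [Fintype K] (ν : K → ℝ) (e : K → KZ.IntegralRep 2),
        (∀ k, IsAlgebraic ℚ (ν k)) → ∑ k, ν k = 0 →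
        (∀ k, (e k).domain =
            {p : Fin 2 → ℝ | p 0 ∈ Set.Ioo (0 : ℝ) 1 ∧ 0 < p 1 ∧ p 1 < |ν k| * g (p 0)} ∧
          ∀ p ∈ (e k).domain, (e k).integrand p = 1) →
        ∑ k, (SignType.sign (ν k) : ℤ) • KZ.of (e k) ∈ planarGroup := by
  sorry

/-- **Stub 3 (Mordell–Weil normal form; the hardest stub, held by the lead).** Every finite
family of standard cells reduces inside the planar set-chain group to algebraic multiples of a
normal basis of standard cells (`[c_k] ≡ Σ_j sign(coef_kj) [d_kj]`, `d_kj` the cell of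
`|coef_kj| · h_j`; the value identity `value c_k = Σ_j coef_kj · value bb_j` then follows from soundness),
the basis areas being certified
independent in one of three shapes: `ℚ̄ ∩ ℝ`-linearly independent outright; toric
(`1, log bᵢ, arctan βₖ` with `ℚ`-independent complex logarithms `log bᵢ, i·arctan βₖ`); or the
real periods of formally independent period symbols of curve type. [folklore] -/
theorem stub_mordellWeilNormalForm :
    ∀ (K : Type) [Fintype K] (g : K → ℝ → ℝ) (c : K → KZ.IntegralRep 2),
      (∀ k, IsSemialgebraicFunOn ℚ {z : Fin 1 → ℝ | z 0 ∈ Set.Ioo (0 : ℝ) 1} (fun z => g k (z 0)) ∧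
        ContDiffOn ℝ 1 (g k) (Set.Ioo (0 : ℝ) 1) ∧ (∀ x ∈ Set.Ioo (0 : ℝ) 1, 0 < g k x) ∧
        IntegrableOn (g k) (Set.Ioo (0 : ℝ) 1)) →
      (∀ k, (c k).domain = {p : Fin 2 → ℝ | p 0 ∈ Set.Ioo (0 : ℝ) 1 ∧ 0 < p 1 ∧ p 1 < g k (p 0)} ∧
        ∀ p ∈ (c k).domain, (c k).integrand p = 1) →
      ∃ (m : ℕ) (h : Fin m → ℝ → ℝ) (bb : Fin m → KZ.IntegralRep 2) (coef : K → Fin m → ℝ)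
        (d : K → Fin m → KZ.IntegralRep 2),
        (∀ j, IsSemialgebraicFunOn ℚ {z : Fin 1 → ℝ | z 0 ∈ Set.Ioo (0 : ℝ) 1} (fun z => h j (z 0)) ∧
          ContDiffOn ℝ 1 (h j) (Set.Ioo (0 : ℝ) 1) ∧ (∀ x ∈ Set.Ioo (0 : ℝ) 1, 0 < h j x) ∧
          IntegrableOn (h j) (Set.Ioo (0 : ℝ) 1)) ∧
        (∀ j, (bb j).domain = {p : Fin 2 → ℝ | p 0 ∈ Set.Ioo (0 : ℝ) 1 ∧ 0 < p 1 ∧ p 1 < h j (p 0)} ∧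
          ∀ p ∈ (bb j).domain, (bb j).integrand p = 1) ∧
        (∀ k j, IsAlgebraic ℚ (coef k j)) ∧
        (∀ k j, (d k j).domain =
            {p : Fin 2 → ℝ | p 0 ∈ Set.Ioo (0 : ℝ) 1 ∧ 0 < p 1 ∧ p 1 < |coef k j| * h j (p 0)} ∧
          ∀ p ∈ (d k j).domain, (d k j).integrand p = 1) ∧
        (∀ k, KZ.of (c k) - ∑ j, (SignType.sign (coef k j) : ℤ) • KZ.of (d k j) ∈ planarGroup) ∧
        ((∀ μ : Fin m → ℝ, (∀ j, IsAlgebraic ℚ (μ j)) → ∑ j, μ j * (bb j).value = 0 → ∀ j, μ j = 0) ∨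
          (∃ (p q : ℕ) (b : Fin p → ℝ) (β : Fin q → ℝ) (e : Fin m ≃ Unit ⊕ (Fin p ⊕ Fin q)),
            (∀ i, IsAlgebraic ℚ (b i) ∧ 0 < b i) ∧ (∀ i, IsAlgebraic ℚ (β i)) ∧
            LinearIndependent ℚ (Sum.elim (fun i => ((Real.log (b i) : ℝ) : ℂ))
              (fun i => Complex.I * ((Real.arctan (β i) : ℝ) : ℂ)) : Fin p ⊕ Fin q → ℂ) ∧
            ∀ j, (bb j).value = Sum.elim (fun _ => (1 : ℝ))
              (Sum.elim (fun i => Real.log (b i)) (fun i => Real.arctan (β i))) (e j)) ∨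
          (∃ t : Fin m → CurvePeriods.PeriodSymbol,
            (∀ j, (((bb j).value : ℝ) : ℂ) = (t j).period) ∧
            ∀ a : Fin m → ℂ, (∀ j, IsAlgebraic ℚ (a j)) →
              (∃ (l : ℕ) (ρ : Fin l → (CurvePeriods.PeriodSymbol →₀ ℂ)) (w : Fin l → ℂ),
                (∀ i, CurvePeriods.IsElementaryRelation (ρ i)) ∧ (∀ i, IsAlgebraic ℚ (w i)) ∧
                ∑ j, a j • Finsupp.single (t j) (1 : ℂ) = ∑ i, w i • ρ i) →
              ∀ j, a j = 0)) := by
  sorry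

/-- **Stub 3a (rung 0 of the normal form: the group law of logarithmic cells is planar).** For
real algebraic `a, b > 1` and planar sets on the logarithmic cells `L(a)`, `L(b)`, `L(ab)`
(`L(x) = {1 < u < x, 0 < v, uv < 1}`, area `log x`): `[L(ab)] − [L(a)] − [L(b)] ∈ planarGroup`
(one cut at `u = a`, one hyperbolic dilation `(u, v) ↦ (u/a, av)`). Registered helper of
`stub_mordellWeilNormalForm` (multiplicative relations of the toric basis). [folklore] -/
theorem stub_logCellLaw :
    ∀ (a b : ℝ), IsAlgebraic ℚ a → IsAlgebraic ℚ b → 1 < a → 1 < b →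
      ∀ (ra rb rab : KZ.IntegralRep 2),
        ra.domain = {q : Fin 2 → ℝ | 1 < q 0 ∧ q 0 < a ∧ 0 < q 1 ∧ q 0 * q 1 < 1} →
        rb.domain = {q : Fin 2 → ℝ | 1 < q 0 ∧ q 0 < b ∧ 0 < q 1 ∧ q 0 * q 1 < 1} →
        rab.domain = {q : Fin 2 → ℝ | 1 < q 0 ∧ q 0 < a * b ∧ 0 < q 1 ∧ q 0 * q 1 < 1} →
        (∀ p ∈ ra.domain, ra.integrand p = 1) → (∀ p ∈ rb.domain, rb.integrand p = 1) →
        (∀ p ∈ rab.domain, rab.integrand p = 1) →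
        KZ.of rab - KZ.of ra - KZ.of rb ∈ planarGroup := by
  sorry

/-- **Stub 3b (rung 0 of the normal form: the addition law of arctangent cells is planar).**
For real algebraic `β, γ > 0` with `βγ < 1` and planar sets on the arctangent cells `A(β)`,
`A(γ)`, `A((β+γ)/(1−βγ))` (`A(x) = {0 < u < x, 0 < v, (1+u²)v < 1}`, area `arctan x`):
`[A(β ⊕ γ)] − [A(β)] − [A(γ)] ∈ planarGroup` (one cut at `u = β`, one Möbius `FiniteMapShear`).
Registered helper of `stub_mordellWeilNormalForm` (circle part of the toric relations). [folklore] -/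
theorem stub_arctanCellLaw :
    ∀ (β γ : ℝ), IsAlgebraic ℚ β → IsAlgebraic ℚ γ → 0 < β → 0 < γ → β * γ < 1 →
      ∀ (rβ rγ rδ : KZ.IntegralRep 2),
        rβ.domain = {q : Fin 2 → ℝ | 0 < q 0 ∧ q 0 < β ∧ 0 < q 1 ∧ (1 + q 0 ^ 2) * q 1 < 1} →
        rγ.domain = {q : Fin 2 → ℝ | 0 < q 0 ∧ q 0 < γ ∧ 0 < q 1 ∧ (1 + q 0 ^ 2) * q 1 < 1} →
        rδ.domain = {q : Fin 2 → ℝ | 0 < q 0 ∧ q 0 < (β + γ) / (1 - β * γ) ∧ 0 < q 1 ∧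
          (1 + q 0 ^ 2) * q 1 < 1} →
        (∀ p ∈ rβ.domain, rβ.integrand p = 1) → (∀ p ∈ rγ.domain, rγ.integrand p = 1) →
        (∀ p ∈ rδ.domain, rδ.integrand p = 1) →
        KZ.of rδ - KZ.of rβ - KZ.of rγ ∈ planarGroup := by
  sorry

/-- **Stub 4 (toric independence = Baker's theorem in real clothes).** LANDED as
`Theorems/SymplecticScissorsPlanarK0InjectiveToricIndependence.lean` (p77887); kept here as a
registered stub with the identical signature (the final file imports the landed theorem).
[cite: Baker1975, Theorem 2.1] -/
theorem stub_toricIndependence :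
    ∀ (p q : ℕ) (b : Fin p → ℝ) (β : Fin q → ℝ), (∀ i, IsAlgebraic ℚ (b i)) → (∀ i, 0 < b i) →
      (∀ i, IsAlgebraic ℚ (β i)) →
      LinearIndependent ℚ (Sum.elim (fun i => ((Real.log (b i) : ℝ) : ℂ))
        (fun i => Complex.I * ((Real.arctan (β i) : ℝ) : ℂ)) : Fin p ⊕ Fin q → ℂ) →
      ∀ μ : Unit ⊕ (Fin p ⊕ Fin q) → ℝ, (∀ j, IsAlgebraic ℚ (μ j)) →
        ∑ j, μ j * Sum.elim (fun _ => (1 : ℝ))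
          (Sum.elim (fun i => Real.log (b i)) (fun i => Real.arctan (β i))) j = 0 →
        ∀ j, μ j = 0 := by
  sorry

/-- **Stub 5 (Huber–Wüstholz 2022, Thm 13.3 (2), the tree's named fact).** Every vanishing
`ℚ̄`-linear combination of periods of curve type is a `ℚ̄`-combination of elementary relations.
This stub IS the named fact `HuberWustholzCurvePeriods` (XL apex of the route; cited, unproved
in the tree). [cite: HuberWustholz2022, Thm. 13.3 (2) (p. 121)] -/
theorem stub_huberWustholz : HuberWustholzCurvePeriods := by
  sorry

/-! ## Sorry-free composition -/

/-- Finite sums of symbols evaluate termwise. [folklore] -/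
theorem evalCombination_sum {ι : Type*} (s : Finset ι) (f : ι → (CurvePeriods.PeriodSymbol →₀ ℂ)) :
    CurvePeriods.evalCombination (∑ i ∈ s, f i) = ∑ i ∈ s, CurvePeriods.evalCombination (f i) := by
  classical
  refine Finset.induction_on s ?_ ?_
  · simp [CurvePeriods.evalCombination]
  · intro a s ha ih
    rw [Finset.sum_insert ha, Finset.sum_insert ha, CurvePeriods.evalCombination_add, ih]

/-- Independence of the basis areas from a FORMALLY INDEPENDENT realisation by period symbols,
given Huber–Wüstholz. [folklore] -/
theorem valueIndependent_of_symbols (hHW : HuberWustholzCurvePeriods) {m : ℕ}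
    (v : Fin m → ℝ) (t : Fin m → CurvePeriods.PeriodSymbol)
    (hreal : ∀ j, ((v j : ℝ) : ℂ) = (t j).period)
    (hFI : ∀ a : Fin m → ℂ, (∀ j, IsAlgebraic ℚ (a j)) →
      (∃ (l : ℕ) (ρ : Fin l → (CurvePeriods.PeriodSymbol →₀ ℂ)) (w : Fin l → ℂ),
        (∀ i, CurvePeriods.IsElementaryRelation (ρ i)) ∧ (∀ i, IsAlgebraic ℚ (w i)) ∧
        ∑ j, a j • Finsupp.single (t j) (1 : ℂ) = ∑ i, w i • ρ i) → ∀ j, a j = 0) :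
    ∀ μ : Fin m → ℝ, (∀ j, IsAlgebraic ℚ (μ j)) → ∑ j, μ j * v j = 0 → ∀ j, μ j = 0 := by
  intro μ hμ hsum j
  classical
  set a : Fin m → ℂ := fun j => ((μ j : ℝ) : ℂ) with ha
  have halg : ∀ j, IsAlgebraic ℚ (a j) := fun j => (hμ j).algebraMap
  set c : CurvePeriods.PeriodSymbol →₀ ℂ := ∑ j, a j • Finsupp.single (t j) (1 : ℂ) with hc
  have hcoef : ∀ s, IsAlgebraic ℚ (c s) := by
    intro s
    rw [← mem_algebraicClosure_iff]
    simp only [hc, Finsupp.coe_finsetSum, Finset.sum_apply, Finsupp.coe_smul, Pi.smul_apply,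
      smul_eq_mul]
    refine Subalgebra.sum_mem _ fun j _ => ?_
    refine Subalgebra.mul_mem _ (mem_algebraicClosure_iff.mpr (halg j)) ?_
    rw [Finsupp.single_apply]
    split_ifs
    · exact Subalgebra.one_mem _
    · exact Subalgebra.zero_mem _
  have heval : CurvePeriods.evalCombination c = 0 := by
    rw [hc, evalCombination_sum]
    have : ∀ j, CurvePeriods.evalCombination (a j • Finsupp.single (t j) (1 : ℂ)) =
        ((μ j * v j : ℝ) : ℂ) := fun j => by
      rw [CurvePeriods.evalCombination_smul, CurvePeriods.evalCombination_single, ← hreal j]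
      push_cast
      simp [ha]
    simp_rw [this]
    rw [← Complex.ofReal_sum, hsum, Complex.ofReal_zero]
  obtain ⟨l, ρ, w, hρ, hw, hcw⟩ := hHW c hcoef heval
  have h0 := hFI a halg ⟨l, ρ, w, hρ, hw, by rw [← hcw]⟩ j
  simpa [ha] using h0

/-- Independence of the basis areas in the TORIC shape, given Baker (stub 4). [folklore] -/
theorem valueIndependent_of_toric {m p q : ℕ} (v : Fin m → ℝ) (b : Fin p → ℝ) (β : Fin q → ℝ)
    (e : Fin m ≃ Unit ⊕ (Fin p ⊕ Fin q))
    (hind : ∀ μ : Unit ⊕ (Fin p ⊕ Fin q) → ℝ, (∀ j, IsAlgebraic ℚ (μ j)) →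
      ∑ j, μ j * Sum.elim (fun _ => (1 : ℝ))
        (Sum.elim (fun i => Real.log (b i)) (fun i => Real.arctan (β i))) j = 0 → ∀ j, μ j = 0)
    (hv : ∀ j, v j = Sum.elim (fun _ => (1 : ℝ))
      (Sum.elim (fun i => Real.log (b i)) (fun i => Real.arctan (β i))) (e j)) :
    ∀ μ : Fin m → ℝ, (∀ j, IsAlgebraic ℚ (μ j)) → ∑ j, μ j * v j = 0 → ∀ j, μ j = 0 := by
  intro μ hμ hsum j
  have key := hind (μ ∘ e.symm) (fun j' => hμ _) ?_ (e j)
  · simpa using key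
  · rw [← hsum, ← e.symm.sum_comp]
    refine Finset.sum_congr rfl fun j' _ => ?_
    simp [hv]

/-- The area of a standard cell `{0 < x < 1, 0 < y < φ x}` (integrand `1`) is `∫₀¹ φ`
(area between two graphs, `MeasureTheory.volume_regionBetween_eq_integral`). [folklore] -/
theorem value_cell (s : KZ.IntegralRep 2) {φ : ℝ → ℝ}
    (hdom : s.domain = {p : Fin 2 → ℝ | p 0 ∈ Set.Ioo (0 : ℝ) 1 ∧ 0 < p 1 ∧ p 1 < φ (p 0)})
    (h1 : ∀ p ∈ s.domain, s.integrand p = 1) (hφ : IntegrableOn φ (Set.Ioo (0 : ℝ) 1))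
    (hnn : ∀ x ∈ Set.Ioo (0 : ℝ) 1, 0 ≤ φ x) :
    s.value = ∫ x in Set.Ioo (0 : ℝ) 1, φ x := by
  have hmeas : MeasurableSet s.domain := KZ.IntegralRep.measurableSet_domain_holds s
  have hvol : volume s.domain = ENNReal.ofReal (∫ x in Set.Ioo (0 : ℝ) 1, φ x) := by
    have h : s.domain =
        MeasurableEquiv.finTwoArrow ⁻¹' regionBetween (fun _ => 0) φ (Set.Ioo 0 1) := by
      rw [hdom]; ext p; simp [regionBetween]
    rw [h, (volume_preserving_finTwoArrow ℝ).measure_preimage_equiv, Measure.volume_eq_prod,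
      volume_regionBetween_eq_integral (integrableOn_const (by simp)) hφ measurableSet_Ioo
        (fun x hx => hnn x hx)]
    simp
  unfold KZ.IntegralRep.value
  rw [setIntegral_congr_fun hmeas (fun p hp => h1 p hp), setIntegral_const, smul_eq_mul, mul_one,
    Measure.real, hvol, ENNReal.toReal_ofReal (setIntegral_nonneg measurableSet_Ioo hnn)]

/-- The area of the cell of `|a| · h` is `|a|` times the area of the cell of `h`. [folklore] -/
theorem value_cell_smul (d bb : KZ.IntegralRep 2) {h : ℝ → ℝ} (a : ℝ)
    (hd : d.domain = {p : Fin 2 → ℝ | p 0 ∈ Set.Ioo (0 : ℝ) 1 ∧ 0 < p 1 ∧ p 1 < |a| * h (p 0)})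
    (hd1 : ∀ p ∈ d.domain, d.integrand p = 1)
    (hbb : bb.domain = {p : Fin 2 → ℝ | p 0 ∈ Set.Ioo (0 : ℝ) 1 ∧ 0 < p 1 ∧ p 1 < h (p 0)})
    (hbb1 : ∀ p ∈ bb.domain, bb.integrand p = 1) (hh : IntegrableOn h (Set.Ioo (0 : ℝ) 1))
    (hpos : ∀ x ∈ Set.Ioo (0 : ℝ) 1, 0 < h x) :
    d.value = |a| * bb.value := by
  rw [value_cell d hd hd1 (hh.const_mul |a|) (fun x hx => mul_nonneg (abs_nonneg a) (hpos x hx).le),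
    value_cell bb hbb hbb1 hh (fun x hx => (hpos x hx).le), integral_const_mul]

/-- Soundness of the planar group on a reading: `value r = Σ value (c i)`. [folklore] -/
theorem value_eq_sum_of_mem {n : ℕ} (r : KZ.IntegralRep 2) (c : Fin n → KZ.IntegralRep 2)
    (h : KZ.of r - ∑ i, KZ.of (c i) ∈ planarGroup) : r.value = ∑ i, (c i).value := by
  have h0 := eval_eq_zero_of_mem_planarGroup h
  rw [map_sub, map_sum, KZ.eval_of] at h0
  simp_rw [KZ.eval_of] at h0
  linarith

/-- **The line concludes the crux BY NAME.** [folklore] -/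
theorem PlanarK0Injective_of : PlanarK0Injective := by
  intro r r' hr hr' hval
  classical
  -- Stub 1: read both planar sets as sums of standard cells.
  obtain ⟨n, g, c, hg, hc, hmem⟩ := stub_cellReading r hr
  obtain ⟨n', g', c', hg', hc', hmem'⟩ := stub_cellReading r' hr'
  -- The joint family, indexed by `Fin n ⊕ Fin n'`.
  set K := Fin n ⊕ Fin n' with hK
  set gK : K → ℝ → ℝ := Sum.elim g g' with hgK
  set cK : K → KZ.IntegralRep 2 := Sum.elim c c' with hcK
  have hgKstd : ∀ k, IsSemialgebraicFunOn ℚ {z : Fin 1 → ℝ | z 0 ∈ Set.Ioo (0 : ℝ) 1}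
      (fun z => gK k (z 0)) ∧ ContDiffOn ℝ 1 (gK k) (Set.Ioo (0 : ℝ) 1) ∧
      (∀ x ∈ Set.Ioo (0 : ℝ) 1, 0 < gK k x) ∧ IntegrableOn (gK k) (Set.Ioo (0 : ℝ) 1) := by
    rintro (i | i)
    · exact hg i
    · exact hg' i
  have hcKcell : ∀ k, (cK k).domain =
      {p : Fin 2 → ℝ | p 0 ∈ Set.Ioo (0 : ℝ) 1 ∧ 0 < p 1 ∧ p 1 < gK k (p 0)} ∧
      ∀ p ∈ (cK k).domain, (cK k).integrand p = 1 := by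
    rintro (i | i)
    · exact hc i
    · exact hc' i
  -- Stub 3: normal form of the joint family.
  obtain ⟨m, h, bb, coef, d, hh, hbb, hcoef, hd, hred, hind⟩ :=
    stub_mordellWeilNormalForm K gK cK hgKstd hcKcell
  -- Values of the reduction (soundness of the planar group + areas of scaled cells).
  have hvalue : ∀ k, (cK k).value = ∑ j, coef k j * (bb j).value := by
    intro k
    have h0 := eval_eq_zero_of_mem_planarGroup (hred k)
    rw [map_sub, map_sum, KZ.eval_of, sub_eq_zero] at h0
    rw [h0]
    refine Finset.sum_congr rfl fun j _ => ?_
    rw [map_zsmul, KZ.eval_of, value_cell_smul (d k j) (bb j) (coef k j) (hd k j).1 (hd k j).2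
      (hbb j).1 (hbb j).2 (hh j).2.2.2 (hh j).2.2.1, zsmul_eq_mul, ← mul_assoc]
    congr 1
    exact_mod_cast sign_mul_abs (coef k j)
  -- Independence of the basis areas (stubs 4 and 5 in the last two shapes).
  have hVI : ∀ μ : Fin m → ℝ, (∀ j, IsAlgebraic ℚ (μ j)) → ∑ j, μ j * (bb j).value = 0 →
      ∀ j, μ j = 0 := by
    rcases hind with hdirect | ⟨p, q, b, β, e, hb, hβ, hli, hv⟩ | ⟨t, hreal, hFI⟩
    · exact hdirect
    · exact valueIndependent_of_toric (fun j => (bb j).value) b β e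
        (stub_toricIndependence p q b β (fun i => (hb i).1) (fun i => (hb i).2) hβ hli) hv
    · exact valueIndependent_of_symbols stub_huberWustholz (fun j => (bb j).value) t hreal hFI
  -- Equal areas force equal normal coordinates.
  set μ : Fin m → ℝ := fun j => (∑ i, coef (Sum.inl i) j) - ∑ i, coef (Sum.inr i) j with hμ
  have hμalg : ∀ j, IsAlgebraic ℚ (μ j) := by
    intro j
    rw [← mem_algebraicClosure_iff]
    refine Subalgebra.sub_mem _ (Subalgebra.sum_mem _ fun i _ => ?_)
      (Subalgebra.sum_mem _ fun i _ => ?_)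
    · exact mem_algebraicClosure_iff.mpr (hcoef _ _)
    · exact mem_algebraicClosure_iff.mpr (hcoef _ _)
  have hrsum : r.value = ∑ i, ∑ j, coef (Sum.inl i) j * (bb j).value := by
    rw [value_eq_sum_of_mem r c hmem]
    exact Finset.sum_congr rfl fun i _ => hvalue (Sum.inl i)
  have hr'sum : r'.value = ∑ i, ∑ j, coef (Sum.inr i) j * (bb j).value := by
    rw [value_eq_sum_of_mem r' c' hmem']
    exact Finset.sum_congr rfl fun i _ => hvalue (Sum.inr i)
  have hμsum : ∑ j, μ j * (bb j).value = 0 := by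
    have e1 : ∑ j, μ j * (bb j).value =
        (∑ i, ∑ j, coef (Sum.inl i) j * (bb j).value) -
          ∑ i, ∑ j, coef (Sum.inr i) j * (bb j).value := by
      rw [Finset.sum_comm (f := fun i j => coef (Sum.inl i) j * (bb j).value),
        Finset.sum_comm (f := fun i j => coef (Sum.inr i) j * (bb j).value),
        ← Finset.sum_sub_distrib]
      refine Finset.sum_congr rfl fun j _ => ?_
      rw [hμ]
      simp only
      rw [sub_mul, Finset.sum_mul, Finset.sum_mul]
    rw [e1, ← hrsum, ← hr'sum, hval, sub_self]
  have hμ0 : ∀ j, μ j = 0 := hVI μ hμalg hμsum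
  -- Stub 2, coordinate by coordinate.
  have hcoord : ∀ j, (∑ i, (SignType.sign (coef (Sum.inl i) j) : ℤ) • KZ.of (d (Sum.inl i) j)) -
      ∑ i, (SignType.sign (coef (Sum.inr i) j) : ℤ) • KZ.of (d (Sum.inr i) j) ∈ planarGroup := by
    intro j
    set ν : K → ℝ := Sum.elim (fun i => coef (Sum.inl i) j) (fun i => -coef (Sum.inr i) j)
      with hν
    have hνalg : ∀ k, IsAlgebraic ℚ (ν k) := by
      rintro (i | i)
      · exact hcoef _ _
      · simpa [hν] using (hcoef (Sum.inr i) j).neg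
    have hνsum : ∑ k, ν k = 0 := by
      rw [Fintype.sum_sum_type]
      simp only [hν, Sum.elim_inl, Sum.elim_inr, Finset.sum_neg_distrib]
      have := hμ0 j
      rw [hμ] at this
      simp only at this
      linarith
    have hνcell : ∀ k, (d k j).domain =
        {p : Fin 2 → ℝ | p 0 ∈ Set.Ioo (0 : ℝ) 1 ∧ 0 < p 1 ∧ p 1 < |ν k| * h j (p 0)} ∧
        ∀ p ∈ (d k j).domain, (d k j).integrand p = 1 := by
      rintro (i | i)
      · simpa [hν] using hd (Sum.inl i) j
      · simpa [hν, abs_neg] using hd (Sum.inr i) j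
    have key := stub_scalarCalculus (h j) (hh j) K ν (fun k => d k j) hνalg hνsum hνcell
    rw [Fintype.sum_sum_type] at key
    simpa [hν, Left.sign_neg, sub_eq_add_neg] using key
  -- Assemble inside the planar group.
  have hsum1 : (∑ i, KZ.of (c i)) - ∑ i, ∑ j, (SignType.sign (coef (Sum.inl i) j) : ℤ) •
      KZ.of (d (Sum.inl i) j) ∈ planarGroup := by
    rw [← Finset.sum_sub_distrib]
    exact AddSubgroup.sum_mem _ fun i _ => hred (Sum.inl i)
  have hsum2 : (∑ i, KZ.of (c' i)) - ∑ i, ∑ j, (SignType.sign (coef (Sum.inr i) j) : ℤ) •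
      KZ.of (d (Sum.inr i) j) ∈ planarGroup := by
    rw [← Finset.sum_sub_distrib]
    exact AddSubgroup.sum_mem _ fun i _ => hred (Sum.inr i)
  have hsum3 : (∑ i, ∑ j, (SignType.sign (coef (Sum.inl i) j) : ℤ) • KZ.of (d (Sum.inl i) j)) -
      ∑ i, ∑ j, (SignType.sign (coef (Sum.inr i) j) : ℤ) • KZ.of (d (Sum.inr i) j) ∈ planarGroup := by
    rw [Finset.sum_comm (f := fun i j => (SignType.sign (coef (Sum.inl i) j) : ℤ) • KZ.of (d (Sum.inl i) j)),
      Finset.sum_comm (f := fun i j => (SignType.sign (coef (Sum.inr i) j) : ℤ) • KZ.of (d (Sum.inr i) j)),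
      ← Finset.sum_sub_distrib]
    exact AddSubgroup.sum_mem _ fun j _ => hcoord j
  have h4 : (∑ i, KZ.of (c i)) - ∑ i, KZ.of (c' i) ∈ planarGroup := by
    have := planarGroup.add_mem (planarGroup.sub_mem hsum1 hsum2) hsum3
    convert this using 1
    abel
  have h5 : KZ.of r - KZ.of r' ∈ planarGroup := by
    have := planarGroup.add_mem (planarGroup.sub_mem hmem hmem') h4
    convert this using 1
    abel
  exact h5

end Summit.KontsevichZagierPeriods.SymplecticScissors.MordellWeil

end
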